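import Mathlib
import Summits.Ventures.PercRepro2.Defs
import Summits.Ventures.PercRepro2.Graph
import Summits.Ventures.PercRepro2.Induced
import Summits.Ventures.PercRepro2.VdBKahn
import Summits.Ventures.PercRepro2.ReimerVdBK
import Summits.Ventures.PercRepro2.ReimerVdBKRegions
import Summits.Ventures.PercRepro2.ReimerVdBKZClosed
import Summits.Ventures.PercRepro2.ReimerVdBKZReduction
import Summits.Ventures.PercRepro2.ReimerVdBKZSplit
import Summits.Ventures.PercRepro2.ReimerVdBKZRecursion
import Summits.Ventures.PercRepro2.ReimerVdBKTypeWeight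
import Summits.Ventures.PercRepro2.ReimerVdBKPairType
import Summits.Ventures.PercRepro2.ReimerVdBKCoreDown

/-!
# (R-1.2) from conditional association given core avoidance
(blind cell PercRepro2, mine-c g46; `conjectures/MINE-C.md` §55.4)

For a Harris pair `(A, X; B, Y)` let `upper₁ = {A ⊆ K₁} ∩ {Y ∩ K₂ = ∅}` and `upper₂ = {B ⊆ K₁} ∩ {X ∩ K₂ = ∅}`
(increasing in `ω`; the left event is `upper₁ ∩ bar upper₂`, the right event `upper₁ ∩ upper₂`), and for a
vertex set `𝒩` let `coreAvoid 𝒩 = {ω : K₁ ∩ K₂ ∩ 𝒩 = ∅}`.  Two conditional-association statements: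

* `NegAssoc`: `#(upper₁ ∩ bar upper₂ ∩ N) · #N ≤ #(upper₁ ∩ N) · #(upper₂ ∩ N)` — given `N`, `ω` and its
  complement are negatively associated;
* `PosAssoc`: `#(upper₁ ∩ N) · #(upper₂ ∩ N) ≤ #(upper₁ ∩ upper₂ ∩ N) · #N` — given `N`, the two upper
  events are positively associated.

Without `N` these are the two Harris steps of `rvdBK_of_disjoint`.  Together they give `CoreDown`
(`coreDown_of_assoc`), and hence, through `rvdBK_of_coreDown`, (R-1.2) for every instance
(`rvdBK_of_assoc`).  Census (§55.4; kits j330557, j330598, j330609): both hold on every graph with ≤ 6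
vertices, every Harris pair, every `𝒩` — and both FAIL when `N` is replaced by «`v` avoided by world 1» or
by «`v` avoided by both worlds» (the lens's (CNA_Z)/(CPA_Z), §52.7).
-/

namespace Summit.Ventures.PercRepro2
namespace ReimerVdBK
open Classical

variable {V : Type*} {E : Type*} [Fintype E] [DecidableEq E] [Fintype V] [DecidableEq V]
variable (ends : E → Sym2 V) (s : V)

/-- The first upper event of the Harris pair: `A ⊆ K₁` and `Y ∩ K₂ = ∅`. -/
def upper₁ (A Y : Finset V) : Set (Config E) :=
  connAll ends s A ∩ bar (avoidAll ends s Y)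

/-- The second upper event of the Harris pair: `B ⊆ K₁` and `X ∩ K₂ = ∅`. -/
def upper₂ (X B : Finset V) : Set (Config E) :=
  connAll ends s B ∩ bar (avoidAll ends s X)

/-- The core-avoidance event: the core `K₁ ∩ K₂` misses `𝒩`. -/
def coreAvoid (N : Finset V) : Set (Config E) :=
  {ω | ∀ v ∈ N, ¬ (Conn ends ω s v ∧ Conn ends (compl ω) s v)}

omit [Fintype E] [DecidableEq E] [Fintype V] [DecidableEq V] in
/-- The left event of the Harris pair is `upper₁ ∩ bar upper₂`. -/
lemma twoWorld_eq_upper (A X B Y : Finset V) :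
    twoWorld ends s A X B Y = upper₁ ends s A Y ∩ bar (upper₂ ends s X B) := by
  ext ω
  simp only [twoWorld, upper₁, upper₂, bar_inter, bar_bar, Set.mem_inter_iff]
  tauto

omit [Fintype E] [DecidableEq E] [Fintype V] in
/-- The right event of the Harris pair is `upper₁ ∩ upper₂`. -/
lemma twoWorld_right_eq_upper (A X B Y : Finset V) :
    twoWorld ends s (A ∪ B) ∅ ∅ (X ∪ Y) = upper₁ ends s A Y ∩ upper₂ ends s X B := by
  ext ω
  simp only [twoWorld, upper₁, upper₂, connAll_union, avoidAll_union, bar_inter, connAll_empty,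
    avoidAll_empty, Set.inter_univ, Set.univ_inter, Set.mem_inter_iff]
  tauto

/-- **Negative association given core avoidance**:
`#(upper₁ ∩ bar upper₂ ∩ N) · #N ≤ #(upper₁ ∩ N) · #(upper₂ ∩ N)`. -/
def NegAssoc (A X B Y N : Finset V) : Prop :=
  count (upper₁ ends s A Y ∩ bar (upper₂ ends s X B) ∩ coreAvoid ends s N) * count (coreAvoid ends s N) ≤
    count (upper₁ ends s A Y ∩ coreAvoid ends s N) * count (upper₂ ends s X B ∩ coreAvoid ends s N)

/-- **Positive association given core avoidance**:
`#(upper₁ ∩ N) · #(upper₂ ∩ N) ≤ #(upper₁ ∩ upper₂ ∩ N) · #N`. -/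
def PosAssoc (A X B Y N : Finset V) : Prop :=
  count (upper₁ ends s A Y ∩ coreAvoid ends s N) * count (upper₂ ends s X B ∩ coreAvoid ends s N) ≤
    count (upper₁ ends s A Y ∩ upper₂ ends s X B ∩ coreAvoid ends s N) * count (coreAvoid ends s N)

/-- The core-restricted count is the count of the event intersected with `coreAvoid`. -/
lemma coreCount_eq_count (A X B Y N : Finset V) :
    coreCount ends s A X B Y N = count (twoWorld ends s A X B Y ∩ coreAvoid ends s N) := by
  unfold coreCount
  rw [pcount_coreW_eq_count]
  rfl

/-- **The two association statements give (CORE↓)** for the Harris pair and the set `N`. -/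
theorem coreDown_of_assoc {A X B Y N : Finset V} (h₁ : NegAssoc ends s A X B Y N)
    (h₂ : PosAssoc ends s A X B Y N) : CoreDown ends s A X B Y N := by
  unfold NegAssoc at h₁
  unfold PosAssoc at h₂
  unfold CoreDown
  rw [coreCount_eq_count, coreCount_eq_count, twoWorld_eq_upper, twoWorld_right_eq_upper]
  have h := h₁.trans h₂
  by_cases hN : count (coreAvoid ends s N) = 0
  · -- nothing survives the conditioning: both sides vanish
    have hsub : ∀ S : Set (Config E), count (S ∩ coreAvoid ends s N) = 0 := fun S =>
      Nat.eq_zero_of_le_zero (hN ▸ count_mono Set.inter_subset_right)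
    rw [hsub, hsub]
  · exact Nat.le_of_mul_le_mul_right h (Nat.pos_of_ne_zero hN)

/-- **(R-1.2) from conditional association**: if, on every graph (with the given vertex and edge types),
every Harris pair and every unmarked set `N` satisfy `NegAssoc` and `PosAssoc`, then (R-1.2) holds for
every instance on every such graph. -/
theorem rvdBK_of_assoc
    (hA : ∀ (ends : E → Sym2 V) (A X B Y N : Finset V), X ∩ Y = ∅ → Disjoint A X → Disjoint B Y →
      (∀ v ∈ N, v ∉ A ∪ B ∪ X ∪ Y) → NegAssoc ends s A X B Y N ∧ PosAssoc ends s A X B Y N) :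
    ∀ (ends : E → Sym2 V) (A X B Y : Finset V), RvdBK ends s A X B Y :=
  rvdBK_of_coreDown s fun ends A X B Y N h1 h2 h3 h4 =>
    coreDown_of_assoc ends s (hA ends A X B Y N h1 h2 h3 h4).1 (hA ends A X B Y N h1 h2 h3 h4).2

end ReimerVdBK
end Summit.Ventures.PercRepro2
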